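import Summits.RiemannHypothesis.RiemannHypothesis.Theorems.GroundBartaEvenWinsBeyondArchDeflationLipschitzMajorant
import HarnessLib

/-!
# RiemannHypothesis / GroundBarta — rung 4 (`EvenWinsBeyondArch`, stmt-RiemannHypothesis-18807 / 18085):
# the window image of an edge-vanishing trial vector OUTSIDE its support — preliminaries

Helper file (`--supports stmt-RiemannHypothesis-18085`), RH-free, Mathlib + landed tree files only, no definitions,
no named facts.  Prover A (g10 of unit `sr-gb-rung-a`), endpoint cell `(log 5)/2`.

Elementary inputs of `…DeflationOutsideImage` (the analytic bound of the window image on the sliver `c' < |y| ≤ c`):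

* `dt_cosh_sinh_le_exp_half`, `dt_cosh_sinh_half_sub_le` — mean value bounds for `cosh(·/2)`, `sinh(·/2)` on `[0, 1]`;
* `dt_norm_poleCoeff_le` — `‖∫ v ch‖, ‖∫ v sh‖ ≤ 2c'G₀ ch(c'/2)` for `v` bounded by `G₀`, supported in `[-c', c']`;
* `dt_integrableOn_archShift` — `t ↦ ρ(t) v(y − t)` is integrable on `(0,∞)` for `y ≥ c'` and `v` bounded Lipschitz
  vanishing off `[-c', c']`.
-/

set_option linter.dupNamespace false

noncomputable section

open MeasureTheory Set Filter
open scoped Topology ENNReal NNReal ComplexConjugate BigOperators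

namespace Summit.RiemannHypothesis.RiemannHypothesis.Theorems.EvenWinsBeyondArch

open Literature.NumberTheory.LFunctions
open Summit.RiemannHypothesis.RiemannHypothesis.Theorems.WeilParity.EvenWinsArch (mul_weilArchDensity_le)

/-! ## Elementary bounds -/

/-- On `[0, 1/2]`: `cosh s ≤ exp (1/2)` and `|sinh s| ≤ exp (1/2)`. [folklore] -/
theorem dt_cosh_sinh_le_exp_half {s : ℝ} (h0 : 0 ≤ s) (h1 : s ≤ 1 / 2) :
    Real.cosh s ≤ Real.exp (1 / 2) ∧ |Real.sinh s| ≤ Real.exp (1 / 2) := by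
  have hc : Real.cosh s ≤ Real.exp (1 / 2) := by
    rw [Real.cosh_eq]
    have e1 : Real.exp (-s) ≤ Real.exp s := Real.exp_le_exp.2 (by linarith)
    have e2 : Real.exp s ≤ Real.exp (1 / 2) := Real.exp_le_exp.2 h1
    linarith
  have habs : |Real.sinh s| ≤ Real.cosh s := by
    rcases le_or_gt 0 (Real.sinh s) with h | h
    · rw [abs_of_nonneg h]; exact (Real.sinh_lt_cosh s).le
    · rw [abs_of_neg h, ← Real.sinh_neg, ← Real.cosh_neg]; exact (Real.sinh_lt_cosh (-s)).le
  exact ⟨hc, habs.trans hc⟩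

/-- Mean value bounds for `cosh(·/2)`, `sinh(·/2)` on `[0, 1]`:
`|cosh(b/2) − cosh(a/2)|, |sinh(b/2) − sinh(a/2)| ≤ exp(1/2)·(b − a)/2` for `0 ≤ a ≤ b ≤ 1`. [folklore] -/
theorem dt_cosh_sinh_half_sub_le {a b : ℝ} (ha : 0 ≤ a) (hab : a ≤ b) (hb : b ≤ 1) :
    |Real.cosh (b / 2) - Real.cosh (a / 2)| ≤ Real.exp (1 / 2) * ((b - a) / 2) ∧
      |Real.sinh (b / 2) - Real.sinh (a / 2)| ≤ Real.exp (1 / 2) * ((b - a) / 2) := by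
  have hmem : ∀ x, x = a / 2 ∨ x = b / 2 → x ∈ Icc (0 : ℝ) (1 / 2) := by
    rintro x (rfl | rfl) <;> constructor <;> linarith
  have hconv : Convex ℝ (Icc (0 : ℝ) (1 / 2)) := convex_Icc _ _
  have e : b / 2 - a / 2 = (b - a) / 2 := by ring
  have hn : ‖b / 2 - a / 2‖ = (b - a) / 2 := by rw [e, Real.norm_eq_abs, abs_of_nonneg (by linarith)]
  constructor
  · have h := hconv.norm_image_sub_le_of_norm_deriv_le (f := Real.cosh) (C := Real.exp (1 / 2))
      (fun x _ ↦ Real.differentiable_cosh x)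
      (fun x hx ↦ by rw [(Real.hasDerivAt_cosh x).deriv, Real.norm_eq_abs]; exact (dt_cosh_sinh_le_exp_half hx.1 hx.2).2)
      (hmem _ (Or.inl rfl)) (hmem _ (Or.inr rfl))
    rwa [hn, Real.norm_eq_abs] at h
  · have h := hconv.norm_image_sub_le_of_norm_deriv_le (f := Real.sinh) (C := Real.exp (1 / 2))
      (fun x _ ↦ Real.differentiable_sinh x)
      (fun x hx ↦ by
        rw [(Real.hasDerivAt_sinh x).deriv, Real.norm_eq_abs, abs_of_pos (Real.cosh_pos x)]
        exact (dt_cosh_sinh_le_exp_half hx.1 hx.2).1)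
      (hmem _ (Or.inl rfl)) (hmem _ (Or.inr rfl))
    rwa [hn, Real.norm_eq_abs] at h

/-! ## The pole coefficients of a bounded window vector -/

/-- `‖∫ v·cosh(x/2)‖ ≤ 2c'G₀ cosh(c'/2)` and `‖∫ v·sinh(x/2)‖ ≤ 2c'G₀ cosh(c'/2)` for `v` bounded by `G₀` and
supported in `[-c', c']`. [folklore] -/
theorem dt_norm_poleCoeff_le {c' : ℝ} (hc' : 0 < c') {v : ℝ → ℂ} {G₀ : ℝ} (hG₀ : ∀ z, ‖v z‖ ≤ G₀)
    (hvs : ∀ z, z ∉ Icc (-c') c' → v z = 0) :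
    ‖∫ x, v x * (Real.cosh (x / 2) : ℂ)‖ ≤ 2 * c' * G₀ * Real.cosh (c' / 2) ∧
      ‖∫ x, v x * (Real.sinh (x / 2) : ℂ)‖ ≤ 2 * c' * G₀ * Real.cosh (c' / 2) := by
  have hG₀0 : 0 ≤ G₀ := (norm_nonneg _).trans (hG₀ 0)
  have hvol : volume (Icc (-c') c') ≠ ⊤ := by rw [Real.volume_Icc]; exact ENNReal.ofReal_ne_top
  have hint : Integrable ((Icc (-c') c').indicator fun _ : ℝ ↦ G₀ * Real.cosh (c' / 2)) :=
    (integrableOn_const hvol).integrable_indicator measurableSet_Icc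
  have hval : ∫ x, (Icc (-c') c').indicator (fun _ : ℝ ↦ G₀ * Real.cosh (c' / 2)) x = 2 * c' * G₀ * Real.cosh (c' / 2) := by
    rw [integral_indicator_const _ measurableSet_Icc, Measure.real, Real.volume_Icc,
      ENNReal.toReal_ofReal (by linarith), smul_eq_mul]
    ring
  have hcosh : ∀ x ∈ Icc (-c') c', Real.cosh (x / 2) ≤ Real.cosh (c' / 2) := by
    intro x hx
    rw [Real.cosh_le_cosh, abs_of_pos (by linarith : 0 < c' / 2)]
    have := abs_le.2 hx
    rw [abs_div, abs_two]
    linarith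
  have key : ∀ (f : ℝ → ℝ), (∀ x, |f x| ≤ Real.cosh (x / 2)) →
      ‖∫ x, v x * (f x : ℂ)‖ ≤ 2 * c' * G₀ * Real.cosh (c' / 2) := by
    intro f hf
    rw [← hval]
    refine norm_integral_le_of_norm_le hint (Eventually.of_forall fun x ↦ ?_)
    by_cases hx : x ∈ Icc (-c') c'
    · rw [indicator_of_mem hx, norm_mul, Complex.norm_real, Real.norm_eq_abs]
      exact mul_le_mul (hG₀ x) ((hf x).trans (hcosh x hx)) (abs_nonneg _) hG₀0
    · rw [indicator_of_notMem hx, hvs x hx, zero_mul, norm_zero]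
  have habs : ∀ x : ℝ, |Real.sinh x| ≤ Real.cosh x := fun x ↦ by
    rcases le_or_gt 0 (Real.sinh x) with h | h
    · rw [abs_of_nonneg h]; exact (Real.sinh_lt_cosh x).le
    · rw [abs_of_neg h, ← Real.sinh_neg, ← Real.cosh_neg]; exact (Real.sinh_lt_cosh (-x)).le
  exact ⟨key _ fun x ↦ by rw [abs_of_pos (Real.cosh_pos _)], key _ fun x ↦ habs _⟩

/-! ## The archimedean layer outside the support -/

/-- For `y ≥ c'` and a bounded Lipschitz `v` vanishing off `[-c', c']`, `t ↦ ρ(t) v(y − t)` is integrable on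
`(0, ∞)` (`‖v(y−t)‖ = ‖v(y−t) − v(y)‖ ≤ Lt` near `0`). [folklore] -/
theorem dt_integrableOn_archShift {c' : ℝ} {v : ℝ → ℂ} (hvm : Measurable v) {G₀ L : ℝ}
    (hG₀ : ∀ z, ‖v z‖ ≤ G₀) (hL : ∀ a b, ‖v a - v b‖ ≤ L * |a - b|) (hvs : ∀ z, z ∉ Icc (-c') c' → v z = 0)
    {y : ℝ} (hy : c' ≤ y) :
    IntegrableOn (fun t ↦ (weilArchDensity t : ℂ) * v (y - t)) (Ioi 0) := by
  have hG₀0 : 0 ≤ G₀ := (norm_nonneg _).trans (hG₀ 0)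
  have hL0 : 0 ≤ L := by
    have h := hL 1 0; rw [sub_zero, abs_one, mul_one] at h; exact (norm_nonneg _).trans h
  have hvy : v y = 0 := by
    rcases eq_or_lt_of_le hy with h | h
    · -- `y = c'`: `v(c') = v(c') - v(c' + 1)`-type argument is not needed: use Lipschitz continuity at the edge
      -- `v` vanishes on `(c', ∞)`, hence at `c'` by continuity (Lipschitz)
      by_contra hne
      have hpos : 0 < ‖v y‖ := norm_pos_iff.2 hne
      set s : ℝ := ‖v y‖ / (2 * (L + 1)) with hs
      have hs0 : 0 < s := by positivity
      have hout : v (y + s) = 0 := hvs _ (fun hm ↦ by have := hm.2; linarith)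
      have h1 := hL y (y + s)
      rw [hout, sub_zero, show y - (y + s) = -s by ring, abs_neg, abs_of_pos hs0] at h1
      have : L * s ≤ ‖v y‖ / 2 := by
        rw [hs]
        have hL1 : 0 < L + 1 := by linarith
        calc L * (‖v y‖ / (2 * (L + 1))) = (L / (L + 1)) * (‖v y‖ / 2) := by field_simp
          _ ≤ 1 * (‖v y‖ / 2) := by
              refine mul_le_mul_of_nonneg_right ?_ (by positivity)
              rw [div_le_one hL1]; linarith
          _ = ‖v y‖ / 2 := one_mul _
      linarith
    · exact hvs y (fun hm ↦ by have := hm.2; linarith)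
  -- domination
  set H : ℝ → ℝ := fun t ↦ (Ioo 0 1).indicator (fun _ ↦ 3 * L / 4) t +
    (Ici 1).indicator (fun t ↦ G₀ * weilArchDensity t) t with hH
  have hvol0 : volume (Ioo (0 : ℝ) 1) ≠ ⊤ := by rw [Real.volume_Ioo]; exact ENNReal.ofReal_ne_top
  have i1 : IntegrableOn (fun t ↦ (Ioo 0 1).indicator (fun _ ↦ 3 * L / 4) t) (Ioi (0 : ℝ)) :=
    ((integrableOn_const hvol0 (C := 3 * L / 4)).integrable_indicator measurableSet_Ioo).integrableOn
  have iR : IntegrableOn (fun t ↦ G₀ * weilArchDensity t) (Ici 1) :=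
    (dt_integrableOn_weilArchDensity_Ici one_pos).const_mul G₀
  have i2 : IntegrableOn (fun t ↦ (Ici 1).indicator (fun t ↦ G₀ * weilArchDensity t) t) (Ioi (0 : ℝ)) :=
    (iR.integrable_indicator measurableSet_Ici).integrableOn
  have hHint : IntegrableOn H (Ioi 0) := i1.add i2
  have hmeas : AEStronglyMeasurable (fun t ↦ (weilArchDensity t : ℂ) * v (y - t)) (volume.restrict (Ioi 0)) :=
    ((Complex.measurable_ofReal.comp measurable_weilArchDensity).mul
      (hvm.comp (measurable_const.sub measurable_id))).aestronglyMeasurable.restrict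
  refine Integrable.mono' hHint hmeas ((ae_restrict_iff' measurableSet_Ioi).2 (Eventually.of_forall
    fun t (ht : 0 < t) ↦ ?_))
  have hρ := (weilArchDensity_pos ht).le
  rw [norm_mul, Complex.norm_real, Real.norm_of_nonneg hρ]
  by_cases ht1 : t < 1
  · have hlip : ‖v (y - t)‖ ≤ L * t := by
      have h := hL (y - t) y
      rw [hvy, sub_zero, show y - t - y = -t by ring, abs_neg, abs_of_pos ht] at h
      exact h
    have h1 : weilArchDensity t * ‖v (y - t)‖ ≤ 3 * L / 4 := by
      calc weilArchDensity t * ‖v (y - t)‖ ≤ weilArchDensity t * (L * t) := mul_le_mul_of_nonneg_left hlip hρ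
        _ = (t * weilArchDensity t) * L := by ring
        _ ≤ (1 / 2 + t / 4) * L := mul_le_mul_of_nonneg_right (mul_weilArchDensity_le ht) hL0
        _ ≤ (1 / 2 + 1 / 4) * L := by refine mul_le_mul_of_nonneg_right ?_ hL0; linarith
        _ = 3 * L / 4 := by ring
    have h2 : 3 * L / 4 ≤ H t := by
      rw [hH]; simp only [indicator_of_mem (show t ∈ Ioo (0 : ℝ) 1 from ⟨ht, ht1⟩)]
      have : 0 ≤ (Ici (1 : ℝ)).indicator (fun t ↦ G₀ * weilArchDensity t) t := by
        by_cases h : t ∈ Ici (1 : ℝ)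
        · rw [indicator_of_mem h]; exact mul_nonneg hG₀0 hρ
        · rw [indicator_of_notMem h]
      linarith
    exact h1.trans h2
  · have h1 : weilArchDensity t * ‖v (y - t)‖ ≤ G₀ * weilArchDensity t := by
      rw [mul_comm]; exact mul_le_mul_of_nonneg_right (hG₀ _) hρ
    have h2 : G₀ * weilArchDensity t ≤ H t := by
      rw [hH]; simp only [indicator_of_mem (show t ∈ Ici (1 : ℝ) from not_lt.1 ht1)]
      have : 0 ≤ (Ioo (0 : ℝ) 1).indicator (fun _ ↦ 3 * L / 4) t := by
        by_cases h : t ∈ Ioo (0 : ℝ) 1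
        · rw [indicator_of_mem h]; positivity
        · rw [indicator_of_notMem h]
      linarith
    exact h1.trans h2

end Summit.RiemannHypothesis.RiemannHypothesis.Theorems.EvenWinsBeyondArch

end
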